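import Mathlib
import HarnessLib
import Summits.ValiantsHypothesis.ValiantsHypothesis.Theorems.MonotoneRestorationOrbitRestorationQPSmlEquivariantForm
import Summits.ValiantsHypothesis.ValiantsHypothesis.Theorems.MonotoneRestorationOrbitRestorationQPSmlAffineNarrow

/-!
# The affine generating family spans the symmetric shadow of a small affine column-sml circuit
(crux `OrbitRestorationQP`, stmt-ValiantsHypothesis-18293 — lane SML of stub A_∞ `stub_sigmaPiSigmaValue`, extension to
depth-three circuits WITH CONSTANTS; `p`-world half of the normal-form extraction)

`…SmlNarrowSpan.lean` / `…SmlEquivariantForm.lean` show that every narrow power-sum product of degree EXACTLY `n` lies in the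
span of the generating family `Q τ = Σ_g (p_1 + Σ_i τ_i y_{g i})^n` (the `x_{ab} ↦ y_a` images of the equivariant terms
`Σ_g Π_b (C_b + Σ_i τ_i x_{(g i,b)})`).  For AFFINE column-sml circuits the symmetric shadow has narrow components in every
degree `e ≤ n` (`SmlAffineNarrow.narrow_of_affineColSml_lt_choose`), so two more steps are needed:

* `Q_expansion_exp`, `wordCount_pos_exp`, `psumProd_mem_span_Q_exp`, `psumProd_multiset_mem_span_Q_exp` — the word
  expansion and grid interpolation of `…SmlNarrowSpan` at an ARBITRARY exponent `e ≤ n`: every power-sum product `p_μ` with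
  `μ.sum = e` and at most `w` parts `≥ 2` lies in `span {Q_e τ = Σ_g (p_1 + Σ_i τ_i y_{g i})^e : τ ∈ {0..n}^w}`;
* `Qexp_mem_span_affineGen` — interpolation in the CONSTANT: with `R β τ = Σ_g (β + p_1 + Σ_i τ_i y_{g i})^n`
  (`β ∈ {0, …, n}`), the binomial expansion `R β τ = Σ_m β^m C(n,m) Q_{n-m} τ` and the 1-D interpolation weights of
  `…SmlInterpolation` give `Q_e τ ∈ span {R β τ : β}` for every `e ≤ n`;
* `rename_fst_prod_affineGenFactor` — `R β τ` IS the symmetric shadow of the affine equivariant terms: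
  `rename fst (Π_b (β + C_b + Σ_i τ_i x_{(g i,b)})) = (β + p_1 + Σ_i τ_i y_{g i})^n`;
* `rename_fst_affineColSml_mem_span_affineGen` — **if `f = Σ_{t<s} Π_b (β_{t,b} + Σ_a α_{t,b,a} x_{(a,b)})` is row- and
  column-symmetric with `s < C(n-(w+1), w+1)`, `2(w+1) ≤ n`, then `rename fst f` lies in the span of the
  `(n+1)^{w+1}` polynomials `R β τ`.**

What remains for the affine stratum of A_∞ (restoration of affine column-sml families): injectivity of `x_{ab} ↦ y_a` on
column-symmetric column-MULTILINEAR polynomials (all degrees) and the assembly as in `SmlEquivariantForm.exists_equivariant_form`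
/ `SmlRestoration.colSml_restoration`.  Honest label: helper theorems for a stratum of the off-path sub-rung A_∞; no stub
closed; VP ≠ VNP untouched. [folklore]
-/

set_option linter.dupNamespace false

namespace Summit.ValiantsHypothesis.ValiantsHypothesis.Theorems.SmlAffineSpan

open MvPolynomial Finset SmlInterpolation SmlNarrowSpan SmlEquivariantForm SmlAffineNarrow

/-! ### Word expansion at an arbitrary exponent `e ≤ n` -/

/-- **Word expansion of the generating family at exponent `e ≤ n`.**
`Σ_{a⃗} (p_1 + Σ_i τ_i y_{a⃗ i})^e = Σ_κ τ^κ • (N_e κ • p_1^{e-|κ|} Π_i p_{κ i})`, `N_e κ` = number of words of length `e` with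
letter profile `κ`. [folklore] -/
theorem Q_expansion_exp (n w e : ℕ) (he : e ≤ n) (τ : Fin w → Fin (n + 1)) :
    ∑ g : Fin w → Fin n, (psum (Fin n) ℂ 1 + ∑ i : Fin w, C (((τ i : ℕ) : ℂ)) * X (g i)) ^ e =
      ∑ κ : Fin w → Fin (n + 1), (∏ i, ((τ i : ℕ) : ℂ) ^ (κ i : ℕ)) •
        (((Finset.univ.filter fun ω : Fin e → Fin (w + 1) =>
            ∀ i : Fin w, (Finset.univ.filter fun m : Fin e => ω m = i.succ).card = (κ i : ℕ)).card : ℂ) •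
          (psum (Fin n) ℂ 1 ^ (e - ∑ i, (κ i : ℕ)) * ∏ i, psum (Fin n) ℂ (κ i))) := by
  classical
  -- the letter profile of a word, as a grid point
  let prof : (Fin e → Fin (w + 1)) → (Fin w → Fin (n + 1)) := fun ω i =>
    ⟨(Finset.univ.filter fun m : Fin e => ω m = i.succ).card,
      Nat.lt_succ_of_le ((Finset.card_filter_le _ _).trans (by rw [Finset.card_univ, Fintype.card_fin]; exact he))⟩
  have hprof : ∀ ω i, ((prof ω i : ℕ)) = (Finset.univ.filter fun m : Fin e => ω m = i.succ).card := fun _ _ => rfl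
  -- expand each power as a sum over words, and evaluate the word products
  have hword : ∀ g : Fin w → Fin n,
      (psum (Fin n) ℂ 1 + ∑ i : Fin w, C (((τ i : ℕ) : ℂ)) * X (g i)) ^ e =
        ∑ ω : Fin e → Fin (w + 1), psum (Fin n) ℂ 1 ^ (e - ∑ i, (prof ω i : ℕ)) *
          ((∏ i, C (((τ i : ℕ) : ℂ)) ^ (prof ω i : ℕ)) * ∏ i, X (g i) ^ (prof ω i : ℕ)) := by
    intro g
    have hcons : psum (Fin n) ℂ 1 + ∑ i : Fin w, C (((τ i : ℕ) : ℂ)) * X (g i) =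
        ∑ l : Fin (w + 1), (Fin.cons (psum (Fin n) ℂ 1) (fun i => C (((τ i : ℕ) : ℂ)) * X (g i)) :
          Fin (w + 1) → MvPolynomial (Fin n) ℂ) l := by
      rw [Fin.sum_univ_succ]; simp
    rw [hcons, Finset.sum_pow', Fintype.piFinset_univ]
    refine Finset.sum_congr rfl fun ω _ => ?_
    rw [prod_word_eq_prod_pow, Fin.prod_univ_succ]
    simp only [Fin.cons_zero, Fin.cons_succ, mul_pow, Finset.prod_mul_distrib]
    congr 1
    · congr 1
      have h := sum_letterCount ω
      rw [Fin.sum_univ_succ] at h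
      simp only [hprof]
      omega
  simp_rw [hword]
  rw [Finset.sum_comm]
  -- sum over `g` inside: `Σ_g Π_i X (g i)^{k i} = Π_i p_{k i}`
  have hinner : ∀ ω : Fin e → Fin (w + 1),
      ∑ g : Fin w → Fin n, psum (Fin n) ℂ 1 ^ (e - ∑ i, (prof ω i : ℕ)) *
          ((∏ i, C (((τ i : ℕ) : ℂ)) ^ (prof ω i : ℕ)) * ∏ i, X (g i) ^ (prof ω i : ℕ)) =
        (∏ i, ((τ i : ℕ) : ℂ) ^ (prof ω i : ℕ)) •
          (psum (Fin n) ℂ 1 ^ (e - ∑ i, (prof ω i : ℕ)) * ∏ i, psum (Fin n) ℂ (prof ω i : ℕ)) := by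
    intro ω
    rw [← Finset.mul_sum, ← Finset.mul_sum, sum_prod_X_pow_eq_prod_psum, smul_eq_C_mul, map_prod]
    simp only [map_pow]
    ring
  simp_rw [hinner]
  -- group the words by profile
  rw [← Finset.sum_fiberwise_of_maps_to (s := Finset.univ) (t := Finset.univ) (g := prof)
    (fun _ _ => Finset.mem_univ _)]
  refine Finset.sum_congr rfl fun κ _ => ?_
  have hfilter : (Finset.univ.filter fun ω : Fin e → Fin (w + 1) => prof ω = κ) =
      Finset.univ.filter fun ω : Fin e → Fin (w + 1) =>
        ∀ i : Fin w, (Finset.univ.filter fun m : Fin e => ω m = i.succ).card = (κ i : ℕ) := by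
    ext ω
    simp only [Finset.mem_filter, Finset.mem_univ, true_and, funext_iff, Fin.ext_iff, hprof]
  rw [Finset.sum_congr rfl (fun ω hω => by rw [(Finset.mem_filter.1 hω).2]), Finset.sum_const, hfilter, smul_comm,
    ← Nat.cast_smul_eq_nsmul ℂ]

/-- **A word of length `e` with prescribed profile** exists whenever `Σ_i κ i ≤ e` (the block word). [folklore] -/
theorem wordCount_pos_exp (n w e : ℕ) (κ : Fin w → Fin (n + 1)) (hκ : ∑ i, (κ i : ℕ) ≤ e) :
    0 < (Finset.univ.filter fun ω : Fin e → Fin (w + 1) =>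
      ∀ i : Fin w, (Finset.univ.filter fun m : Fin e => ω m = i.succ).card = (κ i : ℕ)).card := by
  classical
  rw [Finset.card_pos]
  -- partial sums `S i = Σ_{i' < i} κ i'`
  let S : ℕ → ℕ := fun i => ∑ i' ∈ Finset.range i, if h : i' < w then (κ ⟨i', h⟩ : ℕ) else 0
  have hS_succ : ∀ i : Fin w, S (i + 1) = S i + κ i := by
    intro i
    simp only [S, Finset.sum_range_succ, dif_pos i.isLt]
  have hS_mono : ∀ i i' : ℕ, i ≤ i' → S i ≤ S i' := by
    intro i i' h
    exact Finset.sum_le_sum_of_subset (Finset.range_subset_range.2 h)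
  have hS_w : S w = ∑ i, (κ i : ℕ) := by
    simp only [S]
    rw [← Fin.sum_univ_eq_sum_range (fun i' => if h : i' < w then (κ ⟨i', h⟩ : ℕ) else 0) w]
    exact Finset.sum_congr rfl fun i _ => by rw [dif_pos i.isLt]
  have hS_le : ∀ i : ℕ, i ≤ w → S i ≤ e := fun i hi => (hS_mono i w hi).trans (hS_w ▸ hκ)
  -- the block word: position `m` gets letter `i+1` iff `S i ≤ m < S (i+1)`, else `0`
  let ω : Fin e → Fin (w + 1) := fun m =>
    if h : ∃ i : Fin w, S i ≤ (m : ℕ) ∧ (m : ℕ) < S (i + 1) then (Classical.choose h).succ else 0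
  refine ⟨ω, Finset.mem_filter.2 ⟨Finset.mem_univ _, fun i => ?_⟩⟩
  -- uniqueness of the block containing `m`
  have huniq : ∀ (m : ℕ) (i i' : Fin w), S i ≤ m → m < S (i + 1) → S i' ≤ m → m < S (i' + 1) → i = i' := by
    intro m i i' h1 h2 h3 h4
    by_contra hne
    rcases lt_or_gt_of_ne (fun h : (i : ℕ) = i' => hne (Fin.ext h)) with hlt | hlt
    · have := hS_mono (i + 1) i' (by omega); omega
    · have := hS_mono (i' + 1) i (by omega); omega
  have hωval : ∀ m : Fin e, ω m = i.succ ↔ S i ≤ (m : ℕ) ∧ (m : ℕ) < S (i + 1) := by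
    intro m
    constructor
    · intro h
      simp only [ω] at h
      split_ifs at h with hex
      · have hspec := Classical.choose_spec hex
        rw [Fin.succ_inj] at h
        rw [← h]; exact hspec
      · exact absurd h.symm (Fin.succ_ne_zero _)
    · intro hm
      have hex : ∃ i : Fin w, S i ≤ (m : ℕ) ∧ (m : ℕ) < S (i + 1) := ⟨i, hm⟩
      simp only [ω, dif_pos hex, Fin.succ_inj]
      have hspec := Classical.choose_spec hex
      exact huniq m _ _ hspec.1 hspec.2 hm.1 hm.2
  -- count: the block `{m | S i ≤ m < S (i+1)}` has `κ i` elements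
  have hSi1 : S (i + 1) ≤ e := hS_le (i + 1) (by omega)
  have hcard : (Finset.univ.filter fun m : Fin e => ω m = i.succ).card = (Finset.Ico (S i) (S (i + 1))).card := by
    refine Finset.card_nbij (fun m : Fin e => (m : ℕ)) ?_ ?_ ?_
    · intro m hm
      rw [Finset.mem_coe, Finset.mem_filter, hωval] at hm
      exact Finset.mem_Ico.2 hm.2
    · intro m _ m' _ h
      exact Fin.ext h
    · intro x hx
      rw [Finset.mem_coe, Finset.mem_Ico] at hx
      refine ⟨⟨x, by omega⟩, ?_, rfl⟩
      rw [Finset.mem_coe, Finset.mem_filter, hωval]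
      exact ⟨Finset.mem_univ _, hx.1, hx.2⟩
  rw [hcard, Nat.card_Ico, hS_succ]
  omega

/-- **Narrow power-sum products of degree `e ≤ n` are in the span of the exponent-`e` generating family.**  For `|κ| ≤ e ≤ n`:
`p_1^{e-|κ|} Π_i p_{κ i} ∈ span_ℂ {Σ_g (p_1 + Σ_i τ_i y_{g i})^e : τ ∈ {0..n}^w}`. [folklore] -/
theorem psumProd_mem_span_Q_exp (n w e : ℕ) (he : e ≤ n) (κ : Fin w → Fin (n + 1)) (hκ : ∑ i, (κ i : ℕ) ≤ e) :
    psum (Fin n) ℂ 1 ^ (e - ∑ i, (κ i : ℕ)) * ∏ i, psum (Fin n) ℂ (κ i) ∈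
      Submodule.span ℂ (Set.range fun τ : Fin w → Fin (n + 1) =>
        ∑ g : Fin w → Fin n, (psum (Fin n) ℂ 1 + ∑ i : Fin w, C (((τ i : ℕ) : ℂ)) * X (g i)) ^ e) := by
  classical
  have hV := coeff_mem_span_gridValues n w
    (fun κ : Fin w → Fin (n + 1) =>
      (((Finset.univ.filter fun ω : Fin e → Fin (w + 1) =>
          ∀ i : Fin w, (Finset.univ.filter fun m : Fin e => ω m = i.succ).card = (κ i : ℕ)).card : ℂ) •
        (psum (Fin n) ℂ 1 ^ (e - ∑ i, (κ i : ℕ)) * ∏ i, psum (Fin n) ℂ (κ i))))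
    (fun τ => ∑ g : Fin w → Fin n, (psum (Fin n) ℂ 1 + ∑ i : Fin w, C (((τ i : ℕ) : ℂ)) * X (g i)) ^ e)
    (fun τ => Q_expansion_exp n w e he τ) κ
  have hN : (((Finset.univ.filter fun ω : Fin e → Fin (w + 1) =>
      ∀ i : Fin w, (Finset.univ.filter fun m : Fin e => ω m = i.succ).card = (κ i : ℕ)).card : ℂ)) ≠ 0 := by
    rw [Nat.cast_ne_zero]
    exact (wordCount_pos_exp n w e κ hκ).ne'
  have h := Submodule.smul_mem _ ((((Finset.univ.filter fun ω : Fin e → Fin (w + 1) =>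
      ∀ i : Fin w, (Finset.univ.filter fun m : Fin e => ω m = i.succ).card = (κ i : ℕ)).card : ℂ))⁻¹) hV
  rwa [smul_smul, inv_mul_cancel₀ hN, one_smul] at h

/-- **A narrow power-sum product of degree `e ≤ n` lies in the span of the exponent-`e` generating family.**  For a multiset
`μ` of positive integers with `μ.sum = e ≤ n`, `n ≥ 1`, and at most `w` parts `≥ 2`:
`Π_{k∈μ} p_k ∈ span {Σ_g (p_1 + Σ_i τ_i y_{g i})^e : τ}`. [folklore] -/
theorem psumProd_multiset_mem_span_Q_exp {n w e : ℕ} (hn : 1 ≤ n) (he : e ≤ n) (μ : Multiset ℕ) (hpos : ∀ k ∈ μ, 0 < k)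
    (hsum : μ.sum = e) (hw : (μ.filter fun k => 2 ≤ k).card ≤ w) :
    (μ.map (psum (Fin n) ℂ)).prod ∈
      Submodule.span ℂ (Set.range fun τ : Fin w → Fin (n + 1) =>
        ∑ g : Fin w → Fin n, (psum (Fin n) ℂ 1 + ∑ i : Fin w, C (((τ i : ℕ) : ℂ)) * X (g i)) ^ e) := by
  classical
  set ν := μ.filter fun k => 2 ≤ k with hν
  set u := μ.filter fun k => ¬ 2 ≤ k with hu
  have hμ : μ = ν + u := (Multiset.filter_add_not _ μ).symm
  have hu1 : u = Multiset.replicate u.card 1 := by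
    refine Multiset.eq_replicate_card.2 fun b hb => ?_
    rw [hu, Multiset.mem_filter] at hb
    have := hpos b hb.1
    omega
  have husum : u.sum = u.card := by
    conv_lhs => rw [hu1]
    simp
  have hνsum : ν.sum + u.card = e := by rw [← husum, ← Multiset.sum_add, ← hμ, hsum]
  have hνle : ∀ k ∈ ν, k ≤ n := fun k hk =>
    le_trans (Multiset.le_sum_of_mem hk) (by omega)
  -- the padded list of non-unit parts and the grid point `κ`
  set L : List ℕ := ν.toList ++ List.replicate (w - ν.card) 0 with hL
  have hLlen : L.length = w := by
    rw [hL, List.length_append, Multiset.length_toList, List.length_replicate]; omega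
  have hLle : ∀ x ∈ L, x ≤ n := by
    intro x hx
    rw [hL, List.mem_append, Multiset.mem_toList, List.mem_replicate] at hx
    rcases hx with hx | ⟨_, rfl⟩
    · exact hνle x hx
    · omega
  have hgetD : ∀ i : ℕ, L.getD i 0 ≤ n := by
    intro i
    rcases getD_mem_or_eq L 0 i with h | h
    · exact hLle _ h
    · omega
  set κ : Fin w → Fin (n + 1) := fun i => ⟨L.getD i 0, Nat.lt_succ_of_le (hgetD i)⟩ with hκ
  -- products and sums along `κ`
  have hLprod : (L.map (psum (Fin n) ℂ)).prod =
      (ν.map (psum (Fin n) ℂ)).prod * (n : MvPolynomial (Fin n) ℂ) ^ (w - ν.card) := by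
    rw [hL, List.map_append, List.prod_append, Multiset.prod_map_toList, List.map_replicate, List.prod_replicate,
      psum_zero, Fintype.card_fin]
  have hLsum : L.sum = ν.sum := by
    rw [hL, List.sum_append, Multiset.sum_toList, List.sum_replicate, smul_zero, add_zero]
  have hκprod : ∏ i : Fin w, psum (Fin n) ℂ (κ i) = (L.map (psum (Fin n) ℂ)).prod := by
    rw [← prod_range_getD, hLlen, ← Fin.prod_univ_eq_prod_range (fun i => psum (Fin n) ℂ (L.getD i 0)) w]
  have hκsum : ∑ i : Fin w, (κ i : ℕ) = ν.sum := by
    rw [← hLsum, ← sum_range_getD, hLlen, ← Fin.sum_univ_eq_sum_range (fun i => L.getD i 0) w]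
  have hκle : ∑ i : Fin w, (κ i : ℕ) ≤ e := by rw [hκsum]; omega
  have hmem := psumProd_mem_span_Q_exp n w e he κ hκle
  rw [hκsum, hκprod, hLprod, show e - ν.sum = u.card by omega] at hmem
  -- `p_1^{|u|} · (Π_ν p) · n^{w-|ν|}` versus `Π_μ p = (Π_ν p) · p_1^{|u|}`
  have hμprod : (μ.map (psum (Fin n) ℂ)).prod = (ν.map (psum (Fin n) ℂ)).prod * psum (Fin n) ℂ 1 ^ u.card := by
    conv_lhs => rw [hμ, Multiset.map_add, Multiset.prod_add, hu1]
    rw [Multiset.map_replicate, Multiset.prod_replicate]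
  have hnpow : ((n : ℂ) ^ (w - ν.card)) ≠ 0 := pow_ne_zero _ (by exact_mod_cast (by omega : n ≠ 0))
  have h2 := Submodule.smul_mem _ (((n : ℂ) ^ (w - ν.card))⁻¹) hmem
  rw [show psum (Fin n) ℂ 1 ^ u.card * ((ν.map (psum (Fin n) ℂ)).prod * (n : MvPolynomial (Fin n) ℂ) ^ (w - ν.card)) =
      ((n : ℂ) ^ (w - ν.card)) • ((ν.map (psum (Fin n) ℂ)).prod * psum (Fin n) ℂ 1 ^ u.card) by
    rw [smul_eq_C_mul, map_pow, map_natCast]; ring, smul_smul, inv_mul_cancel₀ hnpow, one_smul] at h2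
  rw [hμprod]
  exact h2

/-! ### Interpolation in the constant -/

/-- **Binomial expansion of the affine generating family**:
`Σ_g (β + p_1 + Σ_i τ_i y_{g i})^n = Σ_{m ≤ n} β^m • (C(n,m) • Σ_g (p_1 + Σ_i τ_i y_{g i})^{n-m})`. [folklore] -/
theorem affineGen_expansion (n w : ℕ) (β : Fin (n + 1)) (τ : Fin w → Fin (n + 1)) :
    ∑ g : Fin w → Fin n, (C ((β : ℕ) : ℂ) + (psum (Fin n) ℂ 1 + ∑ i : Fin w, C (((τ i : ℕ) : ℂ)) * X (g i))) ^ n =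
      ∑ m : Fin (n + 1), (((β : ℕ) : ℂ) ^ (m : ℕ)) •
        (((n.choose m : ℕ) : ℂ) • ∑ g : Fin w → Fin n, (psum (Fin n) ℂ 1 + ∑ i : Fin w, C (((τ i : ℕ) : ℂ)) * X (g i)) ^ (n - m)) := by
  have hterm : ∀ g : Fin w → Fin n,
      (C ((β : ℕ) : ℂ) + (psum (Fin n) ℂ 1 + ∑ i : Fin w, C (((τ i : ℕ) : ℂ)) * X (g i))) ^ n =
        ∑ m : Fin (n + 1), (((β : ℕ) : ℂ) ^ (m : ℕ)) •
          (((n.choose m : ℕ) : ℂ) • (psum (Fin n) ℂ 1 + ∑ i : Fin w, C (((τ i : ℕ) : ℂ)) * X (g i)) ^ (n - m)) := by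
    intro g
    rw [add_pow, ← Fin.sum_univ_eq_sum_range]
    refine Finset.sum_congr rfl fun m _ => ?_
    rw [smul_smul, smul_eq_C_mul]
    simp only [map_mul, map_pow, map_natCast]
    ring
  simp_rw [hterm]
  rw [Finset.sum_comm]
  simp_rw [← Finset.smul_sum]

/-- **The exponent-`e` generating family lies in the span of the affine generating family** (`e ≤ n`): interpolation on the
nodes `β = 0, …, n`. [folklore] -/
theorem Qexp_mem_span_affineGen (n w e : ℕ) (he : e ≤ n) (τ : Fin w → Fin (n + 1)) :
    ∑ g : Fin w → Fin n, (psum (Fin n) ℂ 1 + ∑ i : Fin w, C (((τ i : ℕ) : ℂ)) * X (g i)) ^ e ∈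
      Submodule.span ℂ (Set.range fun β : Fin (n + 1) =>
        ∑ g : Fin w → Fin n, (C ((β : ℕ) : ℂ) + (psum (Fin n) ℂ 1 + ∑ i : Fin w, C (((τ i : ℕ) : ℂ)) * X (g i))) ^ n) := by
  classical
  obtain ⟨c, hc⟩ := exists_interp_weights n
  -- `C(n,m₀) • Q_{n-m₀}` is the interpolation combination `Σ_β c m₀ β • R β`
  have key : ∀ m₀ : Fin (n + 1),
      ((n.choose m₀ : ℕ) : ℂ) • ∑ g : Fin w → Fin n,
          (psum (Fin n) ℂ 1 + ∑ i : Fin w, C (((τ i : ℕ) : ℂ)) * X (g i)) ^ (n - m₀) ∈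
        Submodule.span ℂ (Set.range fun β : Fin (n + 1) =>
          ∑ g : Fin w → Fin n, (C ((β : ℕ) : ℂ) + (psum (Fin n) ℂ 1 + ∑ i : Fin w, C (((τ i : ℕ) : ℂ)) * X (g i))) ^ n) := by
    intro m₀
    -- make the coefficient family opaque so that `smul` lemmas do not penetrate it
    obtain ⟨V, hV⟩ : ∃ V : Fin (n + 1) → MvPolynomial (Fin n) ℂ, ∀ m : Fin (n + 1), V m =
        ((n.choose m : ℕ) : ℂ) • ∑ g : Fin w → Fin n,
          (psum (Fin n) ℂ 1 + ∑ i : Fin w, C (((τ i : ℕ) : ℂ)) * X (g i)) ^ (n - m) := ⟨_, fun _ => rfl⟩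
    have hexp : ∀ β : Fin (n + 1),
        ∑ g : Fin w → Fin n, (C ((β : ℕ) : ℂ) + (psum (Fin n) ℂ 1 + ∑ i : Fin w, C (((τ i : ℕ) : ℂ)) * X (g i))) ^ n =
          ∑ m : Fin (n + 1), (((β : ℕ) : ℂ) ^ (m : ℕ)) • V m := by
      intro β
      rw [affineGen_expansion]
      exact Finset.sum_congr rfl fun m _ => by rw [hV m]
    have hcomb : V m₀ = ∑ β : Fin (n + 1), c m₀ β •
        ∑ g : Fin w → Fin n, (C ((β : ℕ) : ℂ) + (psum (Fin n) ℂ 1 + ∑ i : Fin w, C (((τ i : ℕ) : ℂ)) * X (g i))) ^ n := by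
      simp_rw [hexp, Finset.smul_sum, smul_smul]
      rw [Finset.sum_comm]
      simp_rw [← Finset.sum_smul, hc]
      rw [Finset.sum_eq_single m₀]
      · rw [if_pos rfl, one_smul]
      · intro m' _ hne; rw [if_neg (Ne.symm hne), zero_smul]
      · intro h; exact absurd (Finset.mem_univ m₀) h
    rw [← hV m₀, hcomb]
    exact Submodule.sum_mem _ fun β _ => Submodule.smul_mem _ _ (Submodule.subset_span ⟨β, rfl⟩)
  have h := key ⟨n - e, by omega⟩
  simp only [Nat.sub_sub_self he] at h
  have hch : ((n.choose (n - e) : ℕ) : ℂ) ≠ 0 := by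
    rw [Nat.cast_ne_zero]; exact (Nat.choose_pos (by omega)).ne'
  have h2 := Submodule.smul_mem _ (((n.choose (n - e) : ℕ) : ℂ))⁻¹ h
  rwa [smul_smul, inv_mul_cancel₀ hch, one_smul] at h2

/-! ### The affine generating family in the `x`-world -/

/-- `rename fst (Π_b (β + Λ τ g b)) = (β + p_1 + Σ_i τ_i y_{g i})^n`: the affine generator is the symmetric shadow of the
affine equivariant term with constant `β`. [folklore] -/
theorem rename_fst_prod_affineGenFactor {n w : ℕ} (β : Fin (n + 1)) (τ : Fin w → Fin (n + 1)) (g : Fin w → Fin n) :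
    rename (Prod.fst : Fin n × Fin n → Fin n)
        (∏ b : Fin n, (C ((β : ℕ) : ℂ) +
          ∑ a : Fin n, C (1 + ∑ i : Fin w, if g i = a then ((τ i : ℕ) : ℂ) else 0) * X (a, b))) =
      (C ((β : ℕ) : ℂ) + (psum (Fin n) ℂ 1 + ∑ i : Fin w, C (((τ i : ℕ) : ℂ)) * X (g i))) ^ n := by
  have hfac : ∀ b : Fin n, rename (Prod.fst : Fin n × Fin n → Fin n)
      (C ((β : ℕ) : ℂ) + ∑ a : Fin n, C (1 + ∑ i : Fin w, if g i = a then ((τ i : ℕ) : ℂ) else 0) * X (a, b)) =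
      C ((β : ℕ) : ℂ) + (psum (Fin n) ℂ 1 + ∑ i : Fin w, C (((τ i : ℕ) : ℂ)) * X (g i)) := by
    intro b
    rw [map_add, rename_C, ← sum_genCoeff_mul_X τ g]
    simp only [map_sum, map_mul, rename_C, rename_X]
  rw [map_prod, Finset.prod_congr rfl (fun b _ => hfac b), Finset.prod_const, Finset.card_univ, Fintype.card_fin]

/-! ### The symmetric shadow of a small affine column-sml circuit is spanned by the affine generating family -/

/-- **`rename fst f ∈ span {R β τ}`** for a row- and column-symmetric affine column-sml expression `f` with
`s < C(n-(w+1), w+1)` product gates, `2(w+1) ≤ n`. [folklore] -/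
theorem rename_fst_affineColSml_mem_span_affineGen {n s w : ℕ} (h2w : 2 * (w + 1) ≤ n) (β : Fin s → Fin n → ℂ)
    (α : Fin s → Fin n → Fin n → ℂ)
    (hrow : ∀ σ : Equiv.Perm (Fin n), rename (fun v : Fin n × Fin n => (σ v.1, v.2))
      (∑ t : Fin s, ∏ b : Fin n, (C (β t b) + ∑ a : Fin n, C (α t b a) * X (a, b)) : MvPolynomial (Fin n × Fin n) ℂ) =
      ∑ t : Fin s, ∏ b : Fin n, (C (β t b) + ∑ a : Fin n, C (α t b a) * X (a, b)))
    (hcol : ∀ τ : Equiv.Perm (Fin n), rename (fun v : Fin n × Fin n => (v.1, τ v.2))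
      (∑ t : Fin s, ∏ b : Fin n, (C (β t b) + ∑ a : Fin n, C (α t b a) * X (a, b)) : MvPolynomial (Fin n × Fin n) ℂ) =
      ∑ t : Fin s, ∏ b : Fin n, (C (β t b) + ∑ a : Fin n, C (α t b a) * X (a, b)))
    (hs : s < Nat.choose (n - (w + 1)) (w + 1)) :
    rename (Prod.fst : Fin n × Fin n → Fin n)
        (∑ t : Fin s, ∏ b : Fin n, (C (β t b) + ∑ a : Fin n, C (α t b a) * X (a, b))) ∈
      Submodule.span ℂ (Set.range fun βτ : Fin (n + 1) × (Fin w → Fin (n + 1)) =>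
        ∑ g : Fin w → Fin n,
          (C ((βτ.1 : ℕ) : ℂ) + (psum (Fin n) ℂ 1 + ∑ i : Fin w, C (((βτ.2 i : ℕ) : ℂ)) * X (g i))) ^ n) := by
  classical
  have hn : 1 ≤ n := by omega
  obtain ⟨S, c, hS, hp⟩ := narrow_of_affineColSml_lt_choose h2w β α hrow hcol hs
  rw [hp]
  refine Submodule.sum_mem _ fun μ hμ => Submodule.smul_mem _ _ ?_
  obtain ⟨hpos, hsum, hcard⟩ := hS μ hμ
  -- `p_μ ∈ span_τ Q_{μ.sum} τ`, and each `Q_e τ` is in the span of the affine generators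
  have h1 := psumProd_multiset_mem_span_Q_exp (w := w) hn hsum μ hpos rfl (by omega)
  refine (Submodule.span_le.2 ?_) h1
  rintro _ ⟨τ, rfl⟩
  have h2 := Qexp_mem_span_affineGen n w μ.sum hsum τ
  refine (Submodule.span_le.2 ?_) h2
  rintro _ ⟨β', rfl⟩
  exact Submodule.subset_span ⟨(β', τ), rfl⟩

end Summit.ValiantsHypothesis.ValiantsHypothesis.Theorems.SmlAffineSpan
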